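import Summits.QuantumFields.GaugeBoot.TiltedBoxRedLinkCover
import HarnessLib

/-!
# The reduced half of the link mirror of the odd square tilted box: the tube and the far pair terms (gauge-boot, L3 supplement: reduced-half in-plane mirrors, 5b/7)

HONEST FRAMING (cell `pub-gaugeboot`, page 1 of every file): the venture produces certified bounds
on lattice expectations at stated coupling, gauge group, dimension and torus size; NOT a mass gap,
NOT a continuum limit, NOT a string tension; NOT Yang–Mills-summit-bearing (barriers
`FixedCouplingUltralocality`, `PerturbativeInvisibility`). This module is bookkeeping for a small
structural NEGATIVE result (the REDUCED-half in-plane mirrors of the square tilted boxes are not of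
positive type in `d ≥ 3` at small coupling); it discharges nothing by itself.

## Content (odd box `ℤ^d/Γ(2P+1, 2P+1, L)`, `P ≥ 2`, `L ≥ 2`, compact metrisable `G`, continuous `ρ` with a centre element `ρ z₀ = ω • 1`, `ω ≠ 1`)

For a transverse plaquette `v = (z; q)` of the layer `P` and a transverse plaquette
`u = (w; q)` of the layer `P + 2` (`q₁, q₂ ≠ i`), and a set `Q` of REST plaquettes:

* ★ **`stand_mem_of_pairT_ne_zero`** / **`hang_mem_of_pairT_ne_zero`** — if the pair term
  `T_Q(u, v) ≠ 0` then `Q` contains the standing plaquette of every link of `v` and the hanging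
  plaquette of every link of `u` (an uncovered observable link kills the term by the centre twist,
  `PairExp.pairT_eq_zero_of_uncovered_*`, and the covering rest plaquette is unique,
  `eq_stand_of_isRest` / `eq_hang_of_isRest`);
* `tube q u v` — these eight plaquettes; `card_tube = 8`; ★ **`eq_tube_of_pairT_ne_zero`**:
  `|Q| ≤ 8` and `T_Q(u,v) ≠ 0` force `Q = tube`;
* ★★ **`pairT_far_eq_zero`** — THE FAR PAIR TERMS VANISH THROUGH ORDER 8: for
  `u = (z + 2e_i + T; q)` (the mirror image of `v`, which sits above `v + T`, not above `v`) and
  every `Q ⊆ rest` with `|Q| ≤ 8`, `T_Q(u, v) = 0`: in the forced tube the top link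
  `(z + e_i, q₁)` of the standing plaquette on `(z, q₁)` is read by nothing else
  (`T ≠ 0`, `T + e_{q₂} ≠ 0`), so that plaquette peels off and leaves the link `(z, q₁)` of `v`
  uncovered.

Pure combinatorics plus the two vanishing rules of `PeriodicPairPeel.lean`.
-/

noncomputable section

open QuotientAddGroup Finset Function MeasureTheory

namespace Summit.QuantumFields.GaugeBoot

namespace TiltedRP

namespace RedLink

variable {d : ℕ} {i j : Fin d} {L P N : ℕ} [NeZero L] [NeZero P]
  [DecidableEq (TiltedSite d i j (2 * P + 1) (2 * P + 1) L)]
variable {G : Type*} [Group G] [TopologicalSpace G] [IsTopologicalGroup G] [CompactSpace G]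
  [MeasurableSpace G] [BorelSpace G] [SecondCountableTopology G]
variable (ρ : G →* Matrix (Fin N) (Fin N) ℂ) (q : DirPair d)

/-! ## No marked translation of the odd box vanishes -/

omit [NeZero L] [NeZero P] [DecidableEq (TiltedSite d i j (2 * P + 1) (2 * P + 1) L)] in
/-- `e_k ≠ 0` for every `k` on the odd box with `P ≥ 2`, `L ≥ 2`. [folklore] -/
theorem tiltedUnit_ne_zero_all (hP : 2 ≤ P) (hij : i ≠ j) (hL : 2 ≤ L) (k : Fin d) :
    tiltedUnit d i j (2 * P + 1) (2 * P + 1) L k ≠ 0 := by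
  by_cases hki : k = i
  · subst hki
    intro h
    have h1 := congrArg (axisCoord d L (2 * P + 1)) h
    rw [axisCoord_tiltedUnit_self, map_zero] at h1
    have h2 := congrArg ZMod.val h1
    rw [ZMod.val_one'' (by omega : 2 * P + 1 ≠ 1), ZMod.val_zero] at h2
    exact one_ne_zero h2
  · by_cases hkj : k = j
    · subst hkj; exact SquareBox.tiltedUnit_right_ne_zero hij
    · exact SquareBox.tiltedUnit_other_ne_zero hki hkj hL

/-! ## Forced plaquettes -/

section Forced

variable {z w : TiltedSite d i j (2 * P + 1) (2 * P + 1) L} {Q : Finset (Plaq (TiltedSite d i j (2 * P + 1) (2 * P + 1) L) d)}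

omit [NeZero L] [NeZero P] [DecidableEq (TiltedSite d i j (2 * P + 1) (2 * P + 1) L)] in
/-- A transverse plaquette of another layer does not contain a link of `(x; q)`. [folklore] -/
theorem not_hasLink_of_val_ne (hq1 : q.1.1 ≠ i) (hq2 : q.1.2 ≠ i) {x x' : TiltedSite d i j (2 * P + 1) (2 * P + 1) L}
    (h : (axisCoord d L (2 * P + 1) x).val ≠ (axisCoord d L (2 * P + 1) x').val)
    {ℓ : Link (TiltedSite d i j (2 * P + 1) (2 * P + 1) L) d}
    (hℓ : PairExp.HasLink (tiltedUnit d i j (2 * P + 1) (2 * P + 1) L) (x, q) ℓ) :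
    ¬ PairExp.HasLink (tiltedUnit d i j (2 * P + 1) (2 * P + 1) L) (x', q) ℓ :=
  not_hasLink_transverse_of_axisCoord_ne q hq1 hq2 (fun h' => h (by rw [h'])) hℓ

/-- ★ **A non-zero pair term forces the standing plaquettes of the lower observable**: `v = (z; q)` in
the layer `P`, `u = (w; q)` in the layer `P + 2`, `Q ⊆ rest`, `T_Q(u,v) ≠ 0` ⇒ the standing
plaquette of every link of `v` belongs to `Q`. [folklore] -/
theorem stand_mem_of_pairT_ne_zero (hP : 2 ≤ P) (hij : i ≠ j) (hL : 2 ≤ L) (hq1 : q.1.1 ≠ i) (hq2 : q.1.2 ≠ i)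
    (hρ : Continuous ρ) {z₀ : G} {ω : ℂ} (hz₀ : ρ z₀ = ω • (1 : Matrix (Fin N) (Fin N) ℂ)) (hω : ω ≠ 1) {β : ℝ}
    (hz : (axisCoord d L (2 * P + 1) z).val = P) (hw : (axisCoord d L (2 * P + 1) w).val = P + 2)
    (hQ : Q ⊆ restSetL d i j L P)
    (hne : PairExp.pairT ρ (tiltedUnit d i j (2 * P + 1) (2 * P + 1) L) β Q (w, q) (z, q) ≠ 0) (a : Fin 4) :
    stand q (PairExp.plink (tiltedUnit d i j (2 * P + 1) (2 * P + 1) L) (z, q) a) ∈ Q := by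
  by_contra hmem
  set ℓ := PairExp.plink (tiltedUnit d i j (2 * P + 1) (2 * P + 1) L) ((z, q) : Plaq _ d) a with hℓ
  have hvℓ : PairExp.HasLink (tiltedUnit d i j (2 * P + 1) (2 * P + 1) L) (z, q) ℓ := ⟨a, rfl⟩
  obtain ⟨hlay, hdir⟩ := hasLink_transverse q hq1 hq2 z hvℓ
  have hℓval : (axisCoord d L (2 * P + 1) ℓ.1).val = P := by rw [hlay, hz]
  refine hne (PairExp.pairT_eq_zero_of_uncovered_right ρ _ β (tiltedUnit_ne_zero_all hP hij hL) hρ hz₀ hω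
    hvℓ (not_hasLink_of_val_ne q hq1 hq2 (by rw [hz, hw]; omega) hvℓ) fun q' hq' hq'ℓ => hmem ?_)
  have h := eq_stand_of_isRest q hP (mem_restSetL.1 (hQ hq')) hdir hℓval (by rw [Prod.mk.eta]; exact hq'ℓ)
  rw [Prod.mk.eta] at h
  rw [← h]; exact hq'

/-- ★ **A non-zero pair term forces the hanging plaquettes of the upper observable.** [folklore] -/
theorem hang_mem_of_pairT_ne_zero (hP : 2 ≤ P) (hij : i ≠ j) (hL : 2 ≤ L) (hq1 : q.1.1 ≠ i) (hq2 : q.1.2 ≠ i)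
    (hρ : Continuous ρ) {z₀ : G} {ω : ℂ} (hz₀ : ρ z₀ = ω • (1 : Matrix (Fin N) (Fin N) ℂ)) (hω : ω ≠ 1) {β : ℝ}
    (hz : (axisCoord d L (2 * P + 1) z).val = P) (hw : (axisCoord d L (2 * P + 1) w).val = P + 2)
    (hQ : Q ⊆ restSetL d i j L P)
    (hne : PairExp.pairT ρ (tiltedUnit d i j (2 * P + 1) (2 * P + 1) L) β Q (w, q) (z, q) ≠ 0) (a : Fin 4) :
    hang q (PairExp.plink (tiltedUnit d i j (2 * P + 1) (2 * P + 1) L) (w, q) a) ∈ Q := by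
  by_contra hmem
  set ℓ := PairExp.plink (tiltedUnit d i j (2 * P + 1) (2 * P + 1) L) ((w, q) : Plaq _ d) a with hℓ
  have huℓ : PairExp.HasLink (tiltedUnit d i j (2 * P + 1) (2 * P + 1) L) (w, q) ℓ := ⟨a, rfl⟩
  obtain ⟨hlay, hdir⟩ := hasLink_transverse q hq1 hq2 w huℓ
  have hℓval : (axisCoord d L (2 * P + 1) ℓ.1).val = P + 2 := by rw [hlay, hw]
  refine hne (PairExp.pairT_eq_zero_of_uncovered_left ρ _ β (tiltedUnit_ne_zero_all hP hij hL) hρ hz₀ hω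
    huℓ (not_hasLink_of_val_ne q hq1 hq2 (by rw [hz, hw]; omega) huℓ) fun q' hq' hq'ℓ => hmem ?_)
  have h := eq_hang_of_isRest q hP (mem_restSetL.1 (hQ hq')) hdir hℓval (by rw [Prod.mk.eta]; exact hq'ℓ)
  rw [Prod.mk.eta] at h
  rw [← h]; exact hq'

end Forced

/-! ## The tube -/

/-- **The tube** between the transverse plaquettes `v` (lower) and `u` (upper): the standing plaquettes
on the four links of `v` and the hanging plaquettes under the four links of `u`. [folklore] -/
def tube (u v : Plaq (TiltedSite d i j (2 * P + 1) (2 * P + 1) L) d) : Finset (Plaq (TiltedSite d i j (2 * P + 1) (2 * P + 1) L) d) :=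
  (univ.image fun a : Fin 4 => stand q (PairExp.plink (tiltedUnit d i j (2 * P + 1) (2 * P + 1) L) v a)) ∪
    univ.image fun a : Fin 4 => hang q (PairExp.plink (tiltedUnit d i j (2 * P + 1) (2 * P + 1) L) u a)

omit [NeZero L] [NeZero P] in
/-- Membership in the tube. [folklore] -/
theorem mem_tube {u v p : Plaq (TiltedSite d i j (2 * P + 1) (2 * P + 1) L) d} :
    p ∈ tube q u v ↔ (∃ a : Fin 4, stand q (PairExp.plink (tiltedUnit d i j (2 * P + 1) (2 * P + 1) L) v a) = p) ∨
      ∃ a : Fin 4, hang q (PairExp.plink (tiltedUnit d i j (2 * P + 1) (2 * P + 1) L) u a) = p := by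
  simp [tube]

section Tube

variable {z w : TiltedSite d i j (2 * P + 1) (2 * P + 1) L}

omit [NeZero L] in
/-- **The tube has eight plaquettes** (`v = (z; q)` in the layer `P`, `u = (w; q)` in the layer
`P + 2`). [folklore] -/
theorem card_tube (hP : 2 ≤ P) (hij : i ≠ j) (hL : 2 ≤ L) (hq1 : q.1.1 ≠ i) (hq2 : q.1.2 ≠ i)
    (hz : (axisCoord d L (2 * P + 1) z).val = P) (hw : (axisCoord d L (2 * P + 1) w).val = P + 2) :
    (tube q (w, q) (z, q)).card = 8 := by
  have he := tiltedUnit_ne_zero_all (d := d) hP hij hL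
  have hinjS : Function.Injective fun a : Fin 4 => stand q (PairExp.plink (tiltedUnit d i j (2 * P + 1) (2 * P + 1) L) ((z, q) : Plaq _ d) a) := by
    intro a b hab
    have ha := (hasLink_transverse q hq1 hq2 z ⟨a, rfl⟩).2
    have hb := (hasLink_transverse q hq1 hq2 z ⟨b, rfl⟩).2
    exact PairExp.plink_injective _ he _ (stand_injective q ha hb hab)
  have hinjH : Function.Injective fun a : Fin 4 => hang q (PairExp.plink (tiltedUnit d i j (2 * P + 1) (2 * P + 1) L) ((w, q) : Plaq _ d) a) := by
    intro a b hab
    have ha := (hasLink_transverse q hq1 hq2 w ⟨a, rfl⟩).2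
    have hb := (hasLink_transverse q hq1 hq2 w ⟨b, rfl⟩).2
    exact PairExp.plink_injective _ he _ (hang_injective q ha hb hab)
  have hdisj : Disjoint (univ.image fun a : Fin 4 => stand q (PairExp.plink (tiltedUnit d i j (2 * P + 1) (2 * P + 1) L) ((z, q) : Plaq _ d) a))
      (univ.image fun a : Fin 4 => hang q (PairExp.plink (tiltedUnit d i j (2 * P + 1) (2 * P + 1) L) ((w, q) : Plaq _ d) a)) := by
    rw [disjoint_left]
    intro p hp hp'
    rw [mem_image] at hp hp'
    obtain ⟨a, -, rfl⟩ := hp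
    obtain ⟨b, -, hb⟩ := hp'
    refine stand_ne_hang q (ℓ' := PairExp.plink (tiltedUnit d i j (2 * P + 1) (2 * P + 1) L) ((w, q) : Plaq _ d) b) ?_ ?_ hb.symm
    · rw [(hasLink_transverse q hq1 hq2 z ⟨a, rfl⟩).1, hz]
    · rw [(hasLink_transverse q hq1 hq2 w ⟨b, rfl⟩).1, hw]
  unfold tube
  rw [card_union_of_disjoint hdisj, card_image_of_injective _ hinjS, card_image_of_injective _ hinjH]
  simp

/-- ★ **A non-zero pair term of order `≤ 8` is the tube term**: `Q ⊆ rest`, `|Q| ≤ 8`,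
`T_Q(u,v) ≠ 0` ⇒ `Q = tube`. [folklore] -/
theorem eq_tube_of_pairT_ne_zero (hP : 2 ≤ P) (hij : i ≠ j) (hL : 2 ≤ L) (hq1 : q.1.1 ≠ i) (hq2 : q.1.2 ≠ i)
    (hρ : Continuous ρ) {z₀ : G} {ω : ℂ} (hz₀ : ρ z₀ = ω • (1 : Matrix (Fin N) (Fin N) ℂ)) (hω : ω ≠ 1) {β : ℝ}
    (hz : (axisCoord d L (2 * P + 1) z).val = P) (hw : (axisCoord d L (2 * P + 1) w).val = P + 2)
    {Q : Finset (Plaq (TiltedSite d i j (2 * P + 1) (2 * P + 1) L) d)} (hQ : Q ⊆ restSetL d i j L P) (hcard : Q.card ≤ 8)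
    (hne : PairExp.pairT ρ (tiltedUnit d i j (2 * P + 1) (2 * P + 1) L) β Q (w, q) (z, q) ≠ 0) :
    Q = tube q (w, q) (z, q) := by
  symm
  refine eq_of_subset_of_card_le (fun p hp => ?_) (by rw [card_tube q hP hij hL hq1 hq2 hz hw]; exact hcard)
  rcases (mem_tube q).1 hp with ⟨a, rfl⟩ | ⟨a, rfl⟩
  · exact stand_mem_of_pairT_ne_zero ρ q hP hij hL hq1 hq2 hρ hz₀ hω hz hw hQ hne a
  · exact hang_mem_of_pairT_ne_zero ρ q hP hij hL hq1 hq2 hρ hz₀ hω hz hw hQ hne a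

end Tube

/-! ## The far pair terms vanish through order eight -/

omit [NeZero L] [DecidableEq (TiltedSite d i j (2 * P + 1) (2 * P + 1) L)] in
/-- The layer of `z + e_i` is `P + 1` when that of `z` is `P`. [folklore] -/
theorem val_axisCoord_up (hP : 2 ≤ P) {z : TiltedSite d i j (2 * P + 1) (2 * P + 1) L}
    (hz : (axisCoord d L (2 * P + 1) z).val = P) :
    (axisCoord d L (2 * P + 1) (z + tiltedUnit d i j (2 * P + 1) (2 * P + 1) L i)).val = P + 1 := by
  rw [val_axisCoord_add_self z (by omega), hz]

omit [NeZero L] [DecidableEq (TiltedSite d i j (2 * P + 1) (2 * P + 1) L)] in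
/-- The layer of `z + 2e_i + T` is `P + 2` when that of `z` is `P`. [folklore] -/
theorem val_axisCoord_upUpT (hP : 2 ≤ P) (hij : i ≠ j) {z : TiltedSite d i j (2 * P + 1) (2 * P + 1) L}
    (hz : (axisCoord d L (2 * P + 1) z).val = P) :
    (axisCoord d L (2 * P + 1) (z + tiltedUnit d i j (2 * P + 1) (2 * P + 1) L i + tiltedUnit d i j (2 * P + 1) (2 * P + 1) L i +
      tiltedTwist d L (2 * P + 1))).val = P + 2 := by
  have h1 := val_axisCoord_up hP hz
  rw [map_add, axisCoord_tiltedTwist d L _ hij, add_zero, val_axisCoord_add_self _ (by rw [h1]; omega), h1]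

/-- ★★ **THE FAR PAIR TERMS VANISH THROUGH ORDER 8.** For `v = (z; q)` in the layer `P`, its mirror
image `u = (z + 2e_i + T; q)`, and every `Q ⊆ rest` with `|Q| ≤ 8`: `T_Q(u, v) = 0`. [folklore] -/
theorem pairT_far_eq_zero (hP : 2 ≤ P) (hij : i ≠ j) (hL : 2 ≤ L) (hq1 : q.1.1 ≠ i) (hq2 : q.1.2 ≠ i)
    (hρ : Continuous ρ) {z₀ : G} {ω : ℂ} (hz₀ : ρ z₀ = ω • (1 : Matrix (Fin N) (Fin N) ℂ)) (hω : ω ≠ 1) (β : ℝ)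
    {z : TiltedSite d i j (2 * P + 1) (2 * P + 1) L} (hz : (axisCoord d L (2 * P + 1) z).val = P)
    {Q : Finset (Plaq (TiltedSite d i j (2 * P + 1) (2 * P + 1) L) d)} (hQ : Q ⊆ restSetL d i j L P) (hcard : Q.card ≤ 8) :
    PairExp.pairT ρ (tiltedUnit d i j (2 * P + 1) (2 * P + 1) L) β Q
      (z + tiltedUnit d i j (2 * P + 1) (2 * P + 1) L i + tiltedUnit d i j (2 * P + 1) (2 * P + 1) L i + tiltedTwist d L (2 * P + 1), q)
      (z, q) = 0 := by
  set e := tiltedUnit d i j (2 * P + 1) (2 * P + 1) L with he_def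
  set w := z + e i + e i + tiltedTwist d L (2 * P + 1) with hw_def
  have he := tiltedUnit_ne_zero_all (d := d) hP hij hL
  have hw : (axisCoord d L (2 * P + 1) w).val = P + 2 := val_axisCoord_upUpT hP hij hz
  have hzi : (axisCoord d L (2 * P + 1) (z + e i)).val = P + 1 := val_axisCoord_up hP hz
  by_contra hne
  have hQt := eq_tube_of_pairT_ne_zero ρ q hP hij hL hq1 hq2 hρ hz₀ hω hz hw hQ hcard hne
  -- the standing plaquette on the link `(z, q₁)` of `v`, its top link, and the link itself
  have h0 : PairExp.plink e ((z, q) : Plaq _ d) 0 = (z, q.1.1) := rfl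
  have hq₀ : stand q ((z, q.1.1) : Link _ d) ∈ Q := by
    rw [← h0]; exact stand_mem_of_pairT_ne_zero ρ q hP hij hL hq1 hq2 hρ hz₀ hω hz hw hQ hne 0
  refine hne (PairExp.pairT_eq_zero_of_lonely_of_uncovered ρ e β he hρ hz₀ hω hq₀
    (ℓ := (z + e i, q.1.1)) ((hasLink_stand_iff q hq1 _).2 (Or.inr (Or.inl rfl))) ?_ ?_ ?_
    (ℓ' := (z, q.1.1)) ⟨0, rfl⟩ ?_ ?_)
  · -- the top link `(z + e_i, q₁)` is read by no other plaquette of the tube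
    intro q' hq' hne'
    rw [hQt, mem_tube] at hq'
    rcases hq' with ⟨a, rfl⟩ | ⟨a, rfl⟩
    · -- another standing plaquette
      intro hl
      obtain ⟨hlay, hdir⟩ := hasLink_transverse q hq1 hq2 z (ℓ := PairExp.plink e ((z, q) : Plaq _ d) a) ⟨a, rfl⟩
      rw [← Prod.mk.eta (p := PairExp.plink e ((z, q) : Plaq _ d) a), hasLink_stand_iff q hdir] at hl
      rcases hl with h | h | h | h
      · exact hq1 (congrArg Prod.snd h)
      · -- same top link ⇒ same link of `v` ⇒ same plaquette
        apply hne'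
        have h1 : (PairExp.plink e ((z, q) : Plaq _ d) a).1 = z := add_right_cancel (congrArg Prod.fst h).symm
        have h2 : (PairExp.plink e ((z, q) : Plaq _ d) a).2 = q.1.1 := (congrArg Prod.snd h).symm
        rw [← Prod.mk.eta (p := PairExp.plink e ((z, q) : Plaq _ d) a), h1, h2]
      · exact hq1 (congrArg Prod.snd h)
      · -- `z + e_i` would be the base of a link of `v`: wrong layer
        have h1 := congrArg (fun l : Link _ d => (axisCoord d L (2 * P + 1) l.1).val) h
        simp only at h1
        rw [hzi, hlay, hz] at h1
        omega
    · -- a hanging plaquette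
      intro hl
      obtain ⟨hlay, hdir⟩ := hasLink_transverse q hq1 hq2 w (ℓ := PairExp.plink e ((w, q) : Plaq _ d) a) ⟨a, rfl⟩
      rw [← Prod.mk.eta (p := PairExp.plink e ((w, q) : Plaq _ d) a), hasLink_hang_iff q hdir] at hl
      rcases hl with h | h | h | h
      · exact hq1 (congrArg Prod.snd h)
      · -- `z + e_i` would be the base of a link of `u`: wrong layer
        have h1 := congrArg (fun l : Link _ d => (axisCoord d L (2 * P + 1) l.1).val) h
        simp only at h1
        rw [hzi, hlay, hw] at h1
        omega
      · exact hq1 (congrArg Prod.snd h)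
      · -- `z + 2e_i` would be the base of a link of `u` of direction `q₁`: `T = 0` or `T + e_{q₂} = 0`
        have h1 : (PairExp.plink e ((w, q) : Plaq _ d) a).1 = z + e i + e i := by
          have := congrArg Prod.fst h; simp only at this
          rw [eq_sub_iff_add_eq] at this; exact this.symm
        have h2 : (PairExp.plink e ((w, q) : Plaq _ d) a).2 = q.1.1 := (congrArg Prod.snd h).symm
        have hq12 : q.1.1 ≠ q.1.2 := ne_of_lt q.2
        fin_cases a
        · -- `a = 0`: base `w = z + 2e_i + T`
          simp only [PairExp.plink] at h1
          exact SquareBox.tiltedTwist_ne_zero (L := L) hij (add_left_cancel (a := z + e i + e i) (by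
            rw [add_zero]; exact h1))
        · simp only [PairExp.plink] at h2; exact hq12 h2.symm
        · -- `a = 2`: base `w + e_{q₂}`
          simp only [PairExp.plink] at h1
          refine SquareBox.tiltedTwist_add_unit_ne_zero (L := L) (by omega) hij hq2
            (add_left_cancel (a := z + e i + e i) ?_)
          rw [add_zero, ← add_assoc]; exact h1
        · simp only [PairExp.plink] at h2; exact hq12 h2.symm
  · -- `u` does not read the top link (layers `P + 2 ≠ P + 1`)
    intro hl
    have h := (hasLink_transverse q hq1 hq2 w hl).1
    have h1 := congrArg ZMod.val h; simp only at h1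
    rw [hzi, hw] at h1; omega
  · -- `v` does not read the top link (layers `P ≠ P + 1`)
    intro hl
    have h := (hasLink_transverse q hq1 hq2 z hl).1
    have h1 := congrArg ZMod.val h; simp only at h1
    rw [hzi, hz] at h1; omega
  · -- `u` does not read the link `(z, q₁)` of `v`
    exact not_hasLink_of_val_ne q hq1 hq2 (by rw [hz, hw]; omega) ⟨0, rfl⟩
  · -- the only rest plaquette through `(z, q₁)` is the standing one
    intro q' hq' hne' hl
    exact hne' (eq_stand_of_isRest q hP (mem_restSetL.1 (hQ hq')) hq1 hz hl)

end RedLink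

end TiltedRP

end Summit.QuantumFields.GaugeBoot

end
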